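import Mathlib
import Summits.NavierStokesRegularity.NavierStokesRegularity.Theorems.TypeIQuarterGateScarEnvelopeTypeISatelliteTowerGalleryNormalForm

/-!
# The self-descending residual: closure of the phase space under root ω-limits; the DSS face

(A) `ExactPhase.of_isRootOmegaLimit` — the phase space of exact minimisers is closed under ROOT
ω-LIMITS (rung (L12) `OmegaOfMinimiserGlobal` in full: every root ω-limit of an exact minimiser is,
a.e. on every `Q_R(0)`, again an exact globally `m⋆`-rated rooted minimiser).  (B) Anchor for the new reduction `scarEnvelopeTypeI_of_noEnvelopedLeaf_noSelfDescending` (module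
`…SatelliteTowerGalleryNormalForm`): its residual «no self-descending node»
(`RootObj M n → ¬ TameRoot n → ¬ RootDescends n n`) CONTAINS the classical DSS wall face — a
ROOTED `λ`-DSS A–B object (`zoom W 0 0 λ = W`, `0 < λ < 1`) with a scar on the sphere `‖z‖ = 1/4`
IS a non-tame self-descending node (`dss_selfDescendingNode`): its zooms along `λ^{k+1}` are all
equal to `W`, so a tangent flow along a subsequence (`exists_tangentU_along`) is a.e. `W` itself,
which gives `RootDescends n n` and, through the root meter `ABTower.not_budgetAt_iff_sphere`
(κ = 4), `¬ TameRoot n`.  Hence the residual exclusion implies the exclusion of such DSS objects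
(`no_dss_sphereScar_of_noSelfDescending`) — the honest «H3 movement 0» statement in the kernel.

HONEST FRAMING: placement of the residual, nothing open is proved — 23843, the DSS wall,
`∀ M A, ¬ EnvelopedLeaf M A`, the route and Navier–Stokes regularity are OPEN.  LEAD-lineage prover
ns-sz-p1 g6; `--supports stmt-NavierStokesRegularity-23843 --as helper`.
-/

noncomputable section

-- the summit-side namespace repeats a component by design (single-conjunct summit, D-0017)
set_option linter.dupNamespace false

open MeasureTheory Set Metric Filter Topology
open scoped ENNReal

namespace Summit.NavierStokesRegularity.NavierStokesRegularity.Cruxes.ScarEnvelopeTypeI.ZoomDictionary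

section Residual

open Literature.Analysis.FluidPDE
variable {W : ℝ → (EuclideanSpace ℝ (Fin 3)) → (EuclideanSpace ℝ (Fin 3))}
  {P : ℝ → (EuclideanSpace ℝ (Fin 3)) → ℝ}
  {H : ℝ → (EuclideanSpace ℝ (Fin 3)) → (EuclideanSpace ℝ (Fin 3)) →L[ℝ] (EuclideanSpace ℝ (Fin 3))}
  {M : ℝ}


/-! ### (A) The phase space is closed under root ω-limits (L12 in full) -/

/-- **Root ω-limits of exact minimisers are exact minimisers** (a.e. on every `Q_R(0)`): the phase
space `ExactPhase M m U P H` is closed under `IsRootOmegaLimit`.  With `ExactPhase.rootZoom` this is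
the card's (L12) `OmegaOfMinimiserGlobal`: `ω_root` of a gallery minimiser consists of rooted, globally
`m`-rated A–B gallery limits (all of whose scars are then exactly `m`-rated by minimality). -/
theorem ExactPhase.of_isRootOmegaLimit {U V : ℝ → (EuclideanSpace ℝ (Fin 3)) → (EuclideanSpace ℝ (Fin 3))}
    {PU : ℝ → (EuclideanSpace ℝ (Fin 3)) → ℝ}
    {HU : ℝ → (EuclideanSpace ℝ (Fin 3)) → (EuclideanSpace ℝ (Fin 3)) →L[ℝ] (EuclideanSpace ℝ (Fin 3))}
    {m : ℝ} (hU : ABTower M U PU HU) (hW : ExactPhase M m U PU HU W) (hω : IsRootOmegaLimit W V) :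
    ∃ V' : ℝ → (EuclideanSpace ℝ (Fin 3)) → (EuclideanSpace ℝ (Fin 3)), ExactPhase M m U PU HU V' ∧
      ∀ R : ℝ, 0 < R → ∀ᵐ z ∂(volume.restrict (parabolicCylinder R (0 : ℝ × (EuclideanSpace ℝ (Fin 3))))),
        V z.1 z.2 = V' z.1 z.2 := by
  obtain ⟨hV3, l, hl, -, hconv⟩ := hω
  -- the zooms `zoom W 0 0 (l j)` lie in the phase space; extract a phase-space limit
  obtain ⟨V', σ, hσ, hV', hconv'⟩ :=
    ExactPhase.exists_seqLimit hU (Ws := fun j => zoom W 0 0 (l j)) fun j => hW.rootZoom (hl j)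
  refine ⟨V', hV', fun R hR => ?_⟩
  obtain ⟨⟨P', H', hAB, -⟩, -⟩ := hW
  have hmeas : ∀ j, AEStronglyMeasurable (Function.uncurry (zoom W 0 0 (l (σ j))))
      (volume.restrict (parabolicCylinder R (0 : ℝ × (EuclideanSpace ℝ (Fin 3))))) := fun j =>
    aestronglyMeasurable_zoom_of_inBall hAB.2.1 0 (hl _) hR
  have h := ae_eq_of_tendsto_eLpNorm_three hmeas (hV3 R hR).1 (hV'.l3loc R hR).1
    ((hconv R hR).comp hσ.tendsto_atTop) (hconv' R hR)
  exact h.mono fun z hz => hz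

/-! ### (B) The DSS face -/

/-- Iterated root zooms of a `λ`-DSS field (`zoom W 0 0 λ = W`) are the field itself. -/
theorem zoom_pow_succ_of_dss {lam : ℝ} (hdss : zoom W 0 0 lam = W) :
    ∀ k : ℕ, zoom W 0 0 (lam ^ (k + 1)) = W := by
  intro k
  induction k with
  | zero => simpa using hdss
  | succ k ih =>
    have h := zoom_zoom_centre W 0 0 (lam ^ (k + 1)) lam
    rw [ih, smul_zero, add_zero, ← pow_succ] at h
    rw [← h, hdss]

/-- **A rooted DSS A–B object with a sphere scar is a non-tame SELF-DESCENDING node.** -/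
theorem dss_selfDescendingNode (h : ABTower M W P H) (h0 : ¬ RegPt W 0) {lam : ℝ} (hlam0 : 0 < lam)
    (hlam1 : lam < 1) (hdss : zoom W 0 0 lam = W) {z : (EuclideanSpace ℝ (Fin 3))} (hz : ‖z‖ = 1 / 4)
    (hzs : ¬ RegPt W z) :
    RootObj M ⟨W, P, H, z⟩ ∧ ¬ TameRoot ⟨W, P, H, z⟩ ∧ RootDescends ⟨W, P, H, z⟩ ⟨W, P, H, z⟩ := by
  have hT : TowerObj M W P := towerObj_of_abTower h
  -- the scales `λ^{k+1} → 0` and a tangent flow along a subsequence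
  have hl : ∀ k : ℕ, 0 < lam ^ (k + 1) := fun k => pow_pos hlam0 _
  have hl0 : Tendsto (fun k : ℕ => lam ^ (k + 1)) atTop (𝓝 0) :=
    (tendsto_pow_atTop_nhds_zero_of_lt_one hlam0.le hlam1).comp (tendsto_add_atTop_nat 1)
  obtain ⟨φ, hφ, Ū, hŪ⟩ := exists_tangentU_along hT 0 hl hl0
  -- the zooms are constantly `W`, so the tangent flow is a.e. `W` on every `Q_R(0)`, `R < 1`
  have hae : ∀ R ∈ Ioo (0 : ℝ) 1,
      ∀ᵐ w ∂(volume.restrict (parabolicCylinder R (0 : ℝ × (EuclideanSpace ℝ (Fin 3))))),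
        Ū w.1 w.2 = W w.1 w.2 := by
    intro R hR
    obtain ⟨-, -, pbar, hTR⟩ := hŪ
    obtain ⟨-, hŪmem, hconv, -⟩ := hTR R hR
    have hmeasv : ∀ j, AEStronglyMeasurable (Function.uncurry (zoom W 0 0 ((fun k => lam ^ (k + 1)) (φ j))))
        (volume.restrict (parabolicCylinder R (0 : ℝ × (EuclideanSpace ℝ (Fin 3))))) := fun j =>
      aestronglyMeasurable_zoom_of_inBall h.2.1 0 (hl _) hR.1
    have hW3 := h.l3loc R hR.1
    have hconstW : Tendsto (fun j => eLpNorm (Function.uncurry (zoom W 0 0 ((fun k => lam ^ (k + 1)) (φ j))) -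
        Function.uncurry W) 3 (volume.restrict (parabolicCylinder R (0 : ℝ × (EuclideanSpace ℝ (Fin 3))))))
        atTop (𝓝 0) := by
      have e : ∀ j, eLpNorm (Function.uncurry (zoom W 0 0 ((fun k => lam ^ (k + 1)) (φ j))) -
          Function.uncurry W) 3 (volume.restrict (parabolicCylinder R (0 : ℝ × (EuclideanSpace ℝ (Fin 3))))) = 0 := by
        intro j
        simp only [zoom_pow_succ_of_dss hdss, sub_self, eLpNorm_zero]
      simp only [e]
      exact tendsto_const_nhds
    have hconv' : Tendsto (fun j => eLpNorm (Function.uncurry (zoom W 0 0 ((fun k => lam ^ (k + 1)) (φ j))) -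
        Function.uncurry Ū) 3 (volume.restrict (parabolicCylinder R (0 : ℝ × (EuclideanSpace ℝ (Fin 3))))))
        atTop (𝓝 0) := hconv
    exact (ae_eq_of_tendsto_eLpNorm_three hmeasv hŪmem.1 hW3.1 hconv' hconstW).mono fun w hw => hw
  have hz1 : ‖z‖ < 1 := by rw [hz]; norm_num
  have hz0 : z ≠ 0 := by
    intro hz0'
    rw [hz0', norm_zero] at hz
    norm_num at hz
  have hŪz : ¬ RegPt Ū z := fun hr => hzs ((regPt_iff_of_ae_eq_of_norm_lt_one hae hz1).1 hr)
  -- non-tame by the root meter (κ = 4), self-descending by the tangent flow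
  have hκ : ‖z‖ = (4 : ℝ)⁻¹ := by rw [hz]; norm_num
  refine ⟨⟨h, h0⟩, (h.not_budgetAt_iff_sphere 0 (by norm_num : (1 : ℝ) < 4)).2 ⟨_, Ū, hŪ, z, hκ, hŪz⟩,
    ⟨_, Ū, hŪ, hae, hz, hz0, hzs⟩⟩

/-- **The self-descending residual contains the DSS face**: excluding self-descending nodes excludes
every rooted `λ`-DSS A–B object (`0 < λ < 1`) with a scar on the sphere `‖z‖ = 1/4`. -/
theorem no_dss_sphereScar_of_noSelfDescending
    (hS : ∀ (M : ℝ) (n : TNode), RootObj M n → ¬ TameRoot n → ¬ RootDescends n n)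
    (h : ABTower M W P H) (h0 : ¬ RegPt W 0) {lam : ℝ} (hlam0 : 0 < lam) (hlam1 : lam < 1)
    (hdss : zoom W 0 0 lam = W) {z : (EuclideanSpace ℝ (Fin 3))} (hz : ‖z‖ = 1 / 4) : RegPt W z := by
  by_contra hzs
  obtain ⟨hn, ht, hd⟩ := dss_selfDescendingNode h h0 hlam0 hlam1 hdss hz hzs
  exact hS M _ hn ht hd

end Residual

end Summit.NavierStokesRegularity.NavierStokesRegularity.Cruxes.ScarEnvelopeTypeI.ZoomDictionary
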